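import Literature.Barriers.HodgeConjecture.IntegralCoefficientsKollarCurves
import HarnessLib

/-!
# Kollár (1992): the two remaining inputs of the barrier as named facts, and the assembly

Sibling of `Literature/Barriers/HodgeConjecture/IntegralCoefficients` (D-0021 catalogue). Fact
decomposition (librarian, 2026-08-16) of the barrier fact
`Literature.Barriers.HodgeConjecture.Kollar1992_nonTorsionClass_notAlgebraic` (a smooth projective
threefold `X/ℂ` with a non-torsion `α ∈ H⁴(X(ℂ); ℤ)` outside `N² H⁴ = integralAlgebraicClasses X 2`
while `D • α ∈ N²`; J. Kollár, Trento examples, LNM 1515 (1992), §1 Lemma p. 134 and Example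
p. 135; C. Soulé, C. Voisin, Adv. Math. 198 (2005), §2 Thm. 2).

The printed proof [Soulé–Voisin 2005, §2]: for a smooth hypersurface `X ⊂ ℙ⁴` of degree `D`,
"`H⁴(X, ℤ) = ℤα`, `⟨α, h⟩ = 1`" (Lefschetz + Poincaré duality), "`Dα = h²` is algebraic", and
"Theorem 2 (Kollár). Assume that for some integer `p` coprime to `6`, `p³` divides `D`. Then for
general `X`, any curve `C ⊂ X` has degree divisible by `p`. Hence the class `α` is not algebraic."
The siblings `…KollarProofs` (ten sections), `…KollarCurves`, `…Support`, `…CurvePurity*` PROVE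
everything of this except two inputs, isolated there as the hypotheses of
`Kollar1992_nonTorsionClass_notAlgebraic_of_degree_ne_zero` with
`ker_restrictComplInt_le_of_forall_isIrreducible`: the Lefschetz theorem with integral
coefficients (`HodgeTheory/HypersurfaceLefschetzIntegral`), the plane section, the support
calculus and the lattice step are theorems. The two inputs, named here (D-0014 named facts):

* `Kollar1992_veryGeneralHypersurface_curveClasses` — **Kollár's theorem** in the cohomological
  form the reduction consumes: there is a smooth hypersurface `X_F ⊂ ℙ⁴_ℂ` (of some degree
  `D ≥ 1`, for some `p ≥ 2`) on which every integral class of degree `4` supported on an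
  irreducible curve `C` is an integral multiple of `p • α`, `α` the generator with `ι_! α = c³` —
  i.e. purity `H⁴_C(X; ℤ) = ℤ · cl(C)`, `cl(C) = (deg C) α` [Fulton 1998, §19.1 Lemma 19.1.1] and
  "any curve `C ⊂ X` has degree divisible by `p`" for the very general `X` of degree `D`, `p³ ∣ D`,
  `(p, 6) = 1` [Soulé–Voisin 2005, §2 Thm. 2; Kollár 1992, §1 Lemma p. 134, Example p. 135];
* `smoothHypersurfaceThreefold_degree_ne_zero` — **the topological degree of a smooth
  hypersurface `X_F ⊂ ℙ⁴_ℂ` is non-zero**: `⟨h³, [X_F(ℂ)]⟩ ≠ 0` for the hyperplane class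
  `h = ι^* c` and any `ℤ`-orientation (`= ± deg F`; Voisin II, §1.2.2 Rem. 1.26; Wirtinger).

* `Kollar1992_nonTorsionClass_notAlgebraic_holds_of` — **the assembly**: the two facts imply the
  barrier fact (orientations of `X_F(ℂ)` and `ℙ⁴(ℂ)` and a generator of `H²(ℙ⁴(ℂ); ℤ)` are supplied
  by the tree: `ComplexPoints.isOrientableOver`, `ComplexPoints.homologicalOrientationIntProjectiveSpace`,
  `ComplexPoints.projectiveSpace_exists_cupPowers_bijective`).

## References

* [KollarTrento1992] J. Kollár, Trento examples §1, Lemma p. 134 and Example p. 135, LNM 1515 (1992).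
* [SouleVoisin2005] C. Soulé, C. Voisin, Adv. Math. 198 (2005), §2 and Thm. 2.
* [Fulton1998] W. Fulton, Intersection Theory, §19.1 Lemma 19.1.1.
* [VoisinHodgeII2003] C. Voisin, Hodge Theory and Complex Algebraic Geometry II, §1.2.2 Thm. 1.23,
  Rem. 1.26.
* [HatcherAT2002] A. Hatcher, Algebraic Topology, Thm. 3.19, Example 3.40, §3.3.
-/

noncomputable section

open CategoryTheory AlgebraicGeometry Set Topology Function
open Literature.AlgebraicTopology.SingularHomology Literature.AlgebraicGeometry.Motives
open Literature.AlgebraicGeometry.Motives.SmoothHypersurface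

namespace Literature.Barriers.HodgeConjecture

section Barriers
section HodgeConjecture

/-- **Kollár's theorem (1992), cohomological form: a smooth hypersurface threefold on which every
class supported on a curve is divisible by `p`.** In print [cite: SouleVoisin2005, §2 Thm. 2]:
"Theorem 2 (Kollár). Assume that for some integer `p` coprime to `6`, `p³` divides `D`. Then for
general `X` [a smooth hypersurface of degree `D` in `ℙ⁴`], any curve `C ⊂ X` has degree divisible
by `p`." (Kollár's own Example, [cite: KollarTrento1992, §1 Lemma p. 134 and Example p. 135]: degree
`3k²`, `(6, k) = 1`, `k ∣ deg C`; proof by degeneration to a general projection of `Y ⊂ ℙᴺ`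
re-embedded by `𝒪(p)`, relative Hilbert schemes being proper with countably many components.)
Combined with purity for an irreducible curve `C` on the smooth projective threefold `X` —
`H⁴_C(X(ℂ); ℤ) = ker (H⁴(X(ℂ); ℤ) → H⁴((X ∖ C)(ℂ); ℤ))` is `ℤ · cl(C)` [cite: Fulton1998, §19.1 Lemma 19.1.1]
— and `cl(C) = (deg C) α` for the generator `α` of `H⁴(X(ℂ); ℤ) = ℤα` with `ι_! α = c³`
(Lefschetz, a theorem of the tree), the printed statement says: every class dying off an irreducible
curve is an integral multiple of `p • α`. Rendered EXISTENTIALLY in the hypersurface (the barrier is an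
`∃`-statement; "very general" hypersurfaces are not in the tree): there are `p ≥ 2`, `D ≥ 1` and a
form `F ∈ ℂ[x₀, …, x₄]` of degree `D` with `X_F = hypersurface F` a smooth projective threefold and
`F ∉ (x₀, x₁)`, such that for all `ℤ`-orientations `μ_X`, `μ_ℙ`, every generator `c` of
`H²(ℙ⁴(ℂ); ℤ)` and every `α ∈ H⁴(X_F(ℂ); ℤ)` with `ι_! α = (c ∪ c) ∪ c`, and every irreducible closed
curve `C ⊆ X_F` (all points of codimension `≥ 2`, some point of codimension `2`),
`ker (H⁴(X_F(ℂ); ℤ) → H⁴((X_F ∖ C)(ℂ); ℤ)) ≤ ℤ · (p • α)`. This is hypothesis `hker` of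
`Kollar1992_nonTorsionClass_notAlgebraic_of_lefschetzH2_of_curves` /
`not_mem_integralAlgebraicClasses_of_curves` (`…KollarCurves`); the purity half is worked bottom-up
in `…CurvePurity`, `…CurveSemipurity`, `…CurvePurityHomology`. [cite: SouleVoisin2005, §2 Thm. 2] [cite: KollarTrento1992, §1 Lemma p. 134 and Example p. 135] [cite: Fulton1998, §19.1 Lemma 19.1.1] -/
def Kollar1992_veryGeneralHypersurface_curveClasses : Prop :=
  ∃ (p D : ℕ) (F : MvPolynomial (Fin (3 + 2)) ℂ), 2 ≤ p ∧ 0 < D ∧ F.IsHomogeneous D ∧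
    IsSmoothProjective 3 (hypersurface F) ∧
    F ∉ Ideal.span (MvPolynomial.X '' {(0 : Fin (3 + 2)), 1} : Set (MvPolynomial (Fin (3 + 2)) ℂ)) ∧
    ∀ (μX : HomologicalOrientation ℤ (ComplexPoints (hypersurface F)) 6)
      (μP : HomologicalOrientation ℤ (ComplexPoints (projectiveSpace 4 ℂ)) 8)
      (c : bettiCohomologyInt (projectiveSpace 4 ℂ) 2),
      Bijective (LinearMap.toSpanSingleton ℤ (bettiCohomologyInt (projectiveSpace 4 ℂ) 2) c) →
      ∀ α : bettiCohomologyInt (hypersurface F) (2 * 2),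
        gysinMap μX μP (AlgPoints.mapContinuous (L := ℂ) (hypersurfaceι F))
            (show 2 * 2 + 2 = 6 from rfl) (show 6 + 2 = 8 from rfl) α =
          cupProduct (show 4 + 2 = 6 from rfl) (cupProduct (show 2 + 2 = 4 from rfl) c c) c →
        ∀ C : Set (hypersurface F).left, IsClosed C → IsIrreducible C →
          (∀ z ∈ C, ((2 : ℕ) : ℕ∞) ≤ Order.coheight z) → (∃ z ∈ C, Order.coheight z = (2 : ℕ)) →
            LinearMap.ker (restrictComplInt (hypersurface F) C (2 * 2)).hom ≤
              Submodule.span ℤ {(p : ℤ) • α}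

/-- **The topological degree of a smooth hypersurface threefold is non-zero** (Voisin II, §1.2.2
Rem. 1.26: for a smooth hypersurface `X ⊂ ℙ⁴` of degree `D`, "a curve `C = X ∩ ℙ²` is of degree `D`",
i.e. `⟨h³, [X(ℂ)]⟩ = deg X = D` for the complex orientation — Wirtinger's theorem; for an arbitrary
`ℤ`-orientation of the connected manifold `X(ℂ)` the value is `± D`). In the tree's rendering: for a
form `F ∈ ℂ[x₀, …, x₄]` of degree `D ≥ 1` with `X_F = hypersurface F` a smooth projective threefold,
every `ℤ`-orientation `μ_X` of `X_F(ℂ)` and every generator `c` of `H²(ℙ⁴(ℂ); ℤ)`,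
`⟨(ι^*c ∪ ι^*c) ∪ ι^*c, [X_F(ℂ)]_{μ_X}⟩ ≠ 0` (`kroneckerPairing`, `fundamentalClass`). Hypothesis `hdeg`
of `Kollar1992_nonTorsionClass_notAlgebraic_of_degree_ne_zero` (`…KollarProofs`, ninth and tenth
sections), where it yields `ι_! 1 ≠ 0`. [cite: VoisinHodgeII2003, §1.2.2 Rem. 1.26] [cite: HatcherAT2002, §3.3 p. 241] -/
def smoothHypersurfaceThreefold_degree_ne_zero : Prop :=
  ∀ (F : MvPolynomial (Fin (3 + 2)) ℂ) (D : ℕ), F.IsHomogeneous D → 0 < D →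
    IsSmoothProjective 3 (hypersurface F) →
    ∀ (μX : HomologicalOrientation ℤ (ComplexPoints (hypersurface F)) 6)
      (c : bettiCohomologyInt (projectiveSpace 4 ℂ) 2),
      Bijective (LinearMap.toSpanSingleton ℤ (bettiCohomologyInt (projectiveSpace 4 ℂ) 2) c) →
      kroneckerPairing ℤ ℤ (ComplexPoints (hypersurface F)) 6
        (cupProduct (show 4 + 2 = 6 from rfl)
          (cupProduct (show 2 + 2 = 4 from rfl)
            (bettiCohomologyInt.map (hypersurfaceι F) 2 c) (bettiCohomologyInt.map (hypersurfaceι F) 2 c))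
          (bettiCohomologyInt.map (hypersurfaceι F) 2 c))
        μX.fundamentalClass ≠ 0

/-- **Assembly of the Kollár barrier fact**: `Kollar1992_nonTorsionClass_notAlgebraic` follows from
Kollár's theorem (`Kollar1992_veryGeneralHypersurface_curveClasses`) and the non-vanishing of the
degree (`smoothHypersurfaceThreefold_degree_ne_zero`) — by
`Kollar1992_nonTorsionClass_notAlgebraic_of_degree_ne_zero` (Lefschetz, plane section, lattice step:
theorems of `…KollarProofs`) and `ker_restrictComplInt_le_of_forall_isIrreducible` (`…KollarCurves`),
with orientations and a generator of `H²(ℙ⁴(ℂ); ℤ)` supplied by the tree. [cite: SouleVoisin2005, §2 Thm. 2] [cite: KollarTrento1992, §1 Lemma p. 134 and Example p. 135] -/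
theorem Kollar1992_nonTorsionClass_notAlgebraic_holds_of
    (hK : Kollar1992_veryGeneralHypersurface_curveClasses)
    (hdeg : smoothHypersurfaceThreefold_degree_ne_zero) :
    Kollar1992_nonTorsionClass_notAlgebraic := by
  obtain ⟨p, D, F, hp, hD, hFD, hXF, hF, hcurves⟩ := hK
  obtain ⟨μX⟩ := (ComplexPoints.isOrientableOver ℤ hXF :
    IsOrientableOver ℤ (ComplexPoints (hypersurface F)) 6)
  let μP : HomologicalOrientation ℤ (ComplexPoints (projectiveSpace 4 ℂ)) 8 :=
    ComplexPoints.homologicalOrientationIntProjectiveSpace 4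
  obtain ⟨c, d, -, -, hbij⟩ := ComplexPoints.projectiveSpace_exists_cupPowers_bijective ℤ 3
  have hgen : Bijective (LinearMap.toSpanSingleton ℤ (bettiCohomologyInt (projectiveSpace 4 ℂ) 2) (d 1)) :=
    hbij 1 le_rfl (by omega)
  exact Kollar1992_nonTorsionClass_notAlgebraic_of_degree_ne_zero hFD hD hXF
    (i := (0 : Fin (3 + 2))) (j := 1) (by decide) hF μX μP (d 1) hgen
    (hdeg F D hFD hD hXF μX (d 1) hgen) hp
    fun α hα Z hZ hZ2 ↦ ker_restrictComplInt_le_of_forall_isIrreducible (r := 2) hXF (by norm_num)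
      (by norm_num) (by norm_num) (hcurves μX μP (d 1) hgen α hα) hZ hZ2

end HodgeConjecture
end Barriers

end Literature.Barriers.HodgeConjecture

end
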